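import Summits.CriticalPhenomena.PercolationContinuityZ3.Theorems.Transplant.SkelPhiCorridorKGReachEC
import Summits.CriticalPhenomena.PercolationContinuityZ3.Theorems.Transplant.SkelPhiCorridorKGReachCQ
import Summits.CriticalPhenomena.PercolationContinuityZ3.Theorems.Transplant.SkelPhiCorridorKGDepthQ
import HarnessLib
/-!
# WAVE-Q binder row «SkelPhiCorridorKGReachEC» ↦ «SkelPhiCorridorKGReachECQ» (quasi-step rung (N3-b); captain gen-1 g4, WAVE-Q-BINDER-rows v0.7/v0.8, row Q37, FLOOR row; family stmt-g33 = «SkelPhiCorridor*» / «SkelPhiFace*»):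
# **THE FACE-STEP OBLIGATION AT HN THROUGH THE CORRIDOR OF RECORD (E-side, C geometry) UNDER EXACT-FOOTPRINT QUASI-STEPS** — `Skelφ.reachOblAtHNF_of_kgCorrECQ` (the y-variant of the original, built on the census-external «SkelPhiCorridorKGYReachC», is not twinned)

builds on p205010 (kernel theorem, internal audit signed; external expert review pending) — nothing in this file uses p205010; nothing here is a claim about any open node (the
quasi-step node's statement, name and wording are a lead's).  Lane `prim-bschramm`, seat `prim-bschramm-stmt` gen 33 (port pen).  Helper file (`--supports stmt-CriticalPhenomena-4575 --as helper`);
def-free.  PORT RULES (captain #6109/#6122 hunk classes + R-1 = L-hp8-1 (b) + R-2 port-only-in-cone): twins of the `hstep`-threading IN-CONE declarations of the tree module «SkelPhiCorridorKGReachEC»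
(sha256 50867d6959b6baf5…, imported), statements and proofs BYTE-IDENTICAL except: (i) `(hstep : Steps G φ) ↦ {M : ℕ} (hqφ : Skelφ.QStepsN G φ M)` with the frame-cost floor
`hPN : M·(kq+3) ≤ Pk.N`; (ii) `reachChainF_of_kgCorrC ↦ reachChainF_of_kgCorrCQ` («SkelPhiCorridorKGReachCQ» Q44), `coreWindow_nonempty_of_qsteps ↦ coreWindow_nonempty_of_qstepsQ` («SkelPhiCorridorKGDepthQ» Q29); (iv) FLOOR tokens (p5-g28's pull list): `KCmax ↦ Pk.N·KCmax` in `hT`, `hr₀`, `hrs`, `hreach`, `hE`, `KCmax + 1 ↦ (KCmax+1)·(Pk.N+2)` in `hcS`,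
and the depth radius row `hRdepth : D₀ + (kq+3)·‖z‖₁ ≤ R ↦ D₀ + M·(kq+3)·‖z‖₁ ≤ R` where present.  Regression: `M = 1`, `Pk.N`-tokens at `qStepsN_of_steps` give the original.
Docstrings and citations are the original's.
-/

noncomputable section

open MeasureTheory ProbabilityTheory
open scoped ENNReal Classical

namespace Summit.CriticalPhenomena.PercolationContinuityZ3.Theorems

namespace Transplant

namespace Skelφ

open Literature.Probability.Percolation Literature.Probability.LatticeModels SimpleGraph GadgetSystem ProbeHistory HSiteScheme Contour KNCells
open KNCells.KSchA KNLevels ChainPlanar ChainPara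
open Literature.Barriers.CriticalPhenomena (graphBall graphBall_mono)
open Skel (winGraph winGraphIn winGraphIn_le ReachOblAtHNF excess)
open SkelI (tanOff)

variable {V : Type} [DecidableEq V] [Countable V] {G : SimpleGraph V} [G.LocallyFinite] {φ : V → Site 2}

/-- **THE (C) RESIDUE AT ONE PROBE, FIRST AXIS, kit at the column end, chain data built, rim excess and depth row discharged** (`reachChainF_of_kgCorrC` with
`Pd := ⟨Rlev, Nk, j₀, j₁, root, Sx, rim⟩`, `hexc` by `real_rim_le_corrO`, `hTne` by `coreWindow_nonempty_of_qsteps`).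
[cite: KozmaNitzan2024, §4 Lemma 12 (pp. 23–25), p. 30 (Step IV)] -/
theorem reachOblAtHNF_of_kgCorrECQ
    -- the scheme, the probe
    {S : KSchA V ℕ} {FD : FaceData V ℕ} {LD : LevelData V ℕ}
    (hL : LevelGeom G S.Γ FD LD) (hQ : QSepGeom G S.Γ) (hSt : StepsGeom S.Γ FD) (hEx : ExitGeom G S.Γ)
    {h : ProbeHistory V} {e : Site 2 × MDir} (hV : S.Valid₂O G h e) {a' : ℕ} (ha' : a' ∈ S.Γ.anchSet (S.aOf₁O G h e) (tgt e))
    {du : MDir} (hdu : du ∈ S.onwardO G h (tgt e))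
    -- the skeleton map, the frame
    (hlipφ : Lip G φ) {M : ℕ} (hqφ : QStepsN G φ M) {Δ : ℕ} (hΔ : ∀ v, G.degree v ≤ Δ)
    {n ℓ : ℕ} {hs v : ℤ} (hn : 1 ≤ n) (c₀ : V) {σ : ℤ} (hσ : σ = 1 ∨ σ = -1) {kq : ℕ} (hκL : hs.natAbs ≤ kq * n)
    -- the corridor of record
    {R' ρ qq W N m₁ Wm₂ Wp₂ m₂ : ℕ}
    (hP₁ : ParkOK (kgPark₁ n ℓ hs v R' ρ qq W N m₁)) (hP₂ : ParkOK (kgPark₂ n ℓ hs v R' ρ qq W N m₁ Wm₂ Wp₂ m₂))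
    (hsplit : (Wm₂ : ℤ) + Wp₂ = (kgPark₁ n ℓ hs v R' ρ qq W N m₁).aHi (m₁ + 1) - ParkPrm.aLo (kgPark₁ n ℓ hs v R' ρ qq W N m₁) (m₁ + 1))
    -- the window
    {w₀ : V} {R r Rl : ℕ} (hr : Rl ≤ r) (hrR : r ≤ R)
    -- kit constants
    (Pk : ApronPrm) {Mz Rs KCmax rs cS cU : ℕ} (hPN : M * (kq + 3) ≤ Pk.N) (hA : Pk.A = (Mz + 1 : ℕ) * (shearUnit n hs : ℤ) + 1)
    (hdD : Pk.d + 2 ≤ shellD Pk) (hDρ : Rs + 1 ≤ shellD Pk) (hKCmax : (shellD Pk + Mz + 1) * (kq + 1) ≤ KCmax)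
    (hT : (shellD Pk : ℤ) + Pk.N * KCmax + Rs ≤ tanOff Pk.ℓs Pk.M)
    (hr₀ : Pk.N * (tanOff Pk.ℓs Pk.M + 2) + Pk.N * Pk.d + (Pk.N * KCmax + Rs) ≤ Pk.r₀) (hR : Pk.r₀ ≤ R) (hr₀1 : 1 ≤ Pk.r₀)
    (hrs : 1 + (Pk.N * (tanOff Pk.ℓs Pk.M + 2) + Pk.N * Pk.d + (Pk.N * KCmax + Rs)) ≤ rs)
    (hcS : (Pk.N + 1) * (tanOff Pk.ℓs Pk.M + 1) + (Pk.N + 1) * Pk.d + (KCmax + 1) * (Pk.N + 2) + cU ≤ cS)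
    (hreach : r + (Pk.N * (tanOff Pk.ℓs Pk.M + 1) + Pk.N * Pk.d + Pk.N * KCmax) ≤ Pk.r₀)
    -- the short region and the zone datum
    (Rg : V → Finset V) (hRg : ∀ c, ∀ u ∈ Rg c, u ∈ graphBall G c Rs) (hRgcard : ∀ c, (Rg c).card ≤ cU) (hcU1 : 1 ≤ cU)
    (Λc : V → ℕ → Finset V) (kz : ℕ) (hΛRg : ∀ c, Λc c kz ⊆ Rg c) (hzconn : ∀ c, ∀ s ∈ Λc c kz, PathIn G (↑(Λc c kz) : Set V) c s)
    (hcz : ∀ c, c ∈ Λc c kz)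
    -- the chain's level data (the chain data is BUILT here)
    {Rlev Nk j₀ j₁ : ℕ} (hj0 : tanOff Pk.ℓs Pk.M ≤ j₀) (hj : j₁ ≤ Rlev) (hRl : Rlev + 1 ≤ R')
    (hE : j₁ + (Pk.N * (tanOff Pk.ℓs Pk.M + 1) + Pk.N * Pk.d + Pk.N * KCmax) ≤ R')
    {Δ' : ℕ} {δ η : ℝ} (hδ : 0 < δ) (hη : η ≤ δ / 2)
    (kk : ℕ) (hN : kk * (Δ + 1) ^ (2 * rs) ≤ Nk) (hk : (1 - (S.p : ℝ) ^ (1 + Δ * cS + cS * cU)) ^ kk ≤ δ)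
    (hcount : 1 / (1 - (S.p : ℝ)) ^ (Δ' * Nk) ≤ δ * ((Finset.Icc j₀ j₁).card : ℝ))
    -- the habitat rows (vertex form) at `Ω := Ewv (aOf₁O) e.1 e.2 ∪ Hfull a' (tgt e) du`
    (hΩball : ∀ u ∈ graphBall G w₀ R, runX φ c₀ n hs σ u ∈ (kgCorrSched hP₁ hP₂ hsplit).prism →
      u ∈ S.Γ.Ewv (S.aOf₁O G h e) e.1 e.2 ∪ FD.Hfull a' (tgt e) du)
    (hreg : ∀ k ≤ (kgCorrSched hP₁ hP₂ hsplit).N, ∀ u ∈ S.Γ.Ewv (S.aOf₁O G h e) e.1 e.2 ∪ FD.Hfull a' (tgt e) du,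
      runX φ c₀ n hs σ u ∈ (kgCorrSched hP₁ hP₂ hsplit).region k → u ∈ S.Γ.Q (S.aOf₁O G h e) (tgt e) ∪ S.Γ.Efar a' (tgt e) du)
    (hM0 : ∀ u ∈ S.Γ.M (S.aOf₁O G h e) (tgt e), runX φ c₀ n hs σ u ∈ ScheduleNP.core (kgCorrSched hP₁ hP₂ hsplit) 0)
    (hlastM : ∀ u ∈ S.Γ.Ewv (S.aOf₁O G h e) e.1 e.2 ∪ FD.Hfull a' (tgt e) du,
      runX φ c₀ n hs σ u ∈ ScheduleNP.core (kgCorrSched hP₁ hP₂ hsplit) ((kgCorrSched hP₁ hP₂ hsplit).N + 1) → u ∈ S.Γ.M a' (tgt e + stepVec du))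
    -- THE DEPTH ROW (replaces `hTne`): the frame origin's depth and one radius row over the prism
    {D₀ : ℕ} (hc₀ : c₀ ∈ graphBall G w₀ D₀)
    (hRdepth : ∀ z ∈ (kgCorrSched hP₁ hP₂ hsplit).prism, D₀ + M * (kq + 3) * ((z 0).natAbs + (z 1).natAbs) ≤ R)
    -- THE RIM EXCESS DEVICE (replaces `hexc`): world rows `hWπ/hWpl` (any planar map `φe`), depth of explored neighbours `hdeep`, excess radius `R₁ ≤ R − Pk.r₀`
    {φe : V → Site 2} {Rw m' R₀ m R₁ : ℕ} {ctr : Site 2}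
    (hWπ : ∀ b ∈ S.Γ.Ewv (S.aOf₁O G h e) e.1 e.2 ∪ FD.Hfull a' (tgt e) du, b ∈ graphBall G w₀ Rw)
    (hWpl : ∀ b ∈ S.Γ.Ewv (S.aOf₁O G h e) e.1 e.2 ∪ FD.Hfull a' (tgt e) du, φe b ∈ (box 2 m').image (fun s => s + ctr))
    (hdeep : ∀ a ∈ S.Vx G h, ∀ b ∈ S.Γ.Ewv (S.aOf₁O G h e) e.1 e.2 ∪ FD.Hfull a' (tgt e) du, b ∉ S.Vx G h → G.Adj a b → a ∈ graphBall G w₀ R₀)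
    (hm : 2 * m' ≤ m)
    (hR₁ : ∀ R'', R₁ ≤ R'' → ∀ (Rw' : ℕ) (D' A' : Finset V), (∀ d ∈ D', d ∈ graphBall G w₀ Rw') →
      (∀ d ∈ D', ∀ d' ∈ D', φe d - φe d' ∈ box 2 m) → A' ⊆ D' → (∀ a ∈ A', a ∈ graphBall G w₀ (R₀ + 1)) →
        (bondPercolation G S.p).real (excess G w₀ R'' D' A') ≤ η)
    (hR₁R : R₁ ≤ R - Pk.r₀)
    -- THE LONG LINKS AT EVERY CENTRE at accuracy `δ³`
    (hlong : ∀ c (τ : ℤ), τ = 1 ∨ τ = -1 → 1 - δ ^ 3 < (bondPercolation G S.p).real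
      (linkIn (pgramPrism G φ c n hs (3 * ℓ) Rl) (Λc c kz) (pgSideHalfW G φ c n hs ℓ Rl σ (σ * τ))))
    (hlongY : ∀ c (τ : ℤ), τ = 1 ∨ τ = -1 → 1 - δ ^ 3 < (bondPercolation G S.p).real
      (linkIn (pgramPrism G φ c n hs (3 * ℓ) Rl) (Λc c kz) (pgTopPieceW G φ c n hs ℓ Rl σ τ v)))
    -- the budget
    {nmax : ℕ} (hnmax : (kgCorrSched hP₁ hP₂ hsplit).N ≤ nmax) :
    Skel.ReachOblAtHNF G nmax S FD Δ' δ h e a' du := by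
  set Ω : Finset V := S.Γ.Ewv (S.aOf₁O G h e) e.1 e.2 ∪ FD.Hfull a' (tgt e) du with hΩ
  set Sc := kgCorrSched hP₁ hP₂ hsplit with hSc
  -- the chain data of the corridor: source the root, support the corridor world, rim := far part of the region window
  set Pd : WinChainData V := ⟨Rlev, Nk, j₀, j₁, S.Γ.root, S.Sx G h e (S.aOf₁O G h e) a' du,
    fun k => (WinIn (runX φ c₀ n hs σ) Ω (Sc.region k)).filter fun u => u ∉ graphBall G w₀ (R - Pk.r₀)⟩ with hPd
  -- depth: the core windows are nonempty
  have hTne : ∀ k ≤ Sc.N, (WinIn (runX φ c₀ n hs σ) Ω (ScheduleNP.core Sc (k + 1))).Nonempty :=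
    coreWindow_nonempty_of_qstepsQ hqφ hn c₀ hs hσ hκL Sc hc₀ hΩball hRdepth
  -- the rim excess under the corridor law, region by region
  have hexc : ∀ k ≤ Sc.N, (prodBernoulli (S.Wcor G FD h e (S.aOf₁O G h e) a' du)).real (⋃ t' ∈ Pd.Rim k, openConn S.Γ.root t') ≤ η := by
    intro k hk
    refine real_rim_le_corrO φe hL hQ hSt hV ha' hdu hWπ hWpl hdeep hm hR₁ hR₁R (Rim := Pd.Rim k) ?_ ?_ ?_
    · intro u hu
      exact ((mem_WinIn (φ := runX φ c₀ n hs σ)).1 (Finset.mem_filter.1 hu).1).1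
    · intro u hu
      obtain ⟨huΩ, hureg⟩ := (mem_WinIn (φ := runX φ c₀ n hs σ)).1 (Finset.mem_filter.1 hu).1
      exact hreg k hk u huΩ hureg
    · intro u hu
      exact (Finset.mem_filter.1 hu).2
  exact reachChainF_of_kgCorrCQ hL hQ hSt hEx hV ha' hdu hlipφ hqφ hΔ hn c₀ hσ hκL hP₁ hP₂ hsplit hr hrR Pk hPN hA hdD hDρ hKCmax hT hr₀
    hR hr₀1 hrs hcS hreach Rg hRg hRgcard hcU1 Λc kz hΛRg hzconn hcz Pd rfl rfl hj0 hj hRl hE hδ hη kk hN hk hcount hΩball hreg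
    (fun k => Finset.filter_subset _ _) (fun k _ u hu hfar => Finset.mem_filter.2 ⟨hu, hfar⟩) hTne hM0 hlastM hexc hlong hlongY hnmax


-- WAVE-Q (R-2 port-only-in-cone): the second resident of the original, built on the census-EXTERNAL «SkelPhiCorridorKGYReachC», is not twinned.

end Skelφ

end Transplant

end Summit.CriticalPhenomena.PercolationContinuityZ3.Theorems

end
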